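import Mathlib
import Summits.Ventures.PercRepro.TriangleCapBipartiteThree

/-!
# PercRepro — FOUR BELOW THE DIAGONAL ON EVERY BIPARTITION WITH MINIMUM DEGREE TWO:
`Σ_v d(v)² + 4 (k − 5) ≤ m·k` for every bipartite spanning graph with at least four missing cross pairs and no vertex
of degree `≤ 1` (p3, gen 39; part 115)

With `G := Σ_{x ∈ X} miss(x)·d(x) + Σ_{y ∉ X} miss(y)·d(y)` (`Σ deficit = 2G`, every missing cross pair paying the
degrees of its ends, gen 36):

* `N₀ ≤ k − 5`: the star bound `N₀ (k − N₀ − 1) ≥ 4 (k − 5)` (`(N₀ − 4)(k − 5 − N₀) ≥ 0`);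
* `N₀ ≥ k − 4`: with every degree `≥ 2` every missing pair pays `≥ 4`, so `G ≥ 4 N₀ ≥ 4 (k − 4)`.

The vertices of degree `≤ 1` are handled on the whole `K₄⁻`-free class by deletion (TriangleCapFourBelowPendant),
so no density is needed here.  **`bipartite_stability_four`**: bipartite spanning, `N₀ ≥ 4`, every degree `≥ 2` ⇒
`Σ_v d(v)² + 4 (k − 5) ≤ m k`; in cherries `bipartite_stability_four_cherries`.  Axioms: standard.
-/

namespace PercRepro

namespace TriangleCap

namespace C047

open Finset

variable {V : Type*} [Fintype V] [DecidableEq V]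

/-- **FOUR BELOW THE DIAGONAL ON EVERY BIPARTITION, MINIMUM DEGREE TWO:** bipartite spanning, at least four missing
cross pairs, every degree `≥ 2` ⇒ `Σ_v d(v)² + 4 (k − 5) ≤ m k`. -/
theorem bipartite_stability_four (D : SimpleGraph V) [DecidableRel D.Adj] (X : Finset V)
    (hbip : ∀ x y, D.Adj x y → (x ∈ X ↔ y ∉ X)) (hN : 4 ≤ (missing D X Xᶜ).card)
    (hdeg : ∀ z, 2 ≤ deg D z) :
    ∑ v, deg D v * deg D v + 4 * (Fintype.card V - 5) ≤ D.edgeFinset.card * Fintype.card V := by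
  have hid := two_mul_sum_deg_sq_add_sum_deficit D
  rw [card_triangles3_eq_zero_of_cliqueFree D (cliqueFree_of_bipartite D X hbip)] at hid
  have hid2 : 2 * ∑ v, deg D v * deg D v + ∑ p ∈ adjPairsAll D, deficit D p =
      2 * (D.edgeFinset.card * Fintype.card V) := by rw [hid]; ring
  suffices h : 8 * (Fintype.card V - 5) ≤ ∑ p ∈ adjPairsAll D, deficit D p by omega
  have hG := sum_deficit_eq_two_mul_of_bipartite D X hbip
  by_cases hNk : (missing D X Xᶜ).card + 5 ≤ Fintype.card V
  · -- the star bound: `N₀ (k − N₀ − 1) ≥ 4 (k − 5)` for `4 ≤ N₀ ≤ k − 5`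
    have h1 := sum_deficit_ge_of_bipartite D X hbip
    obtain ⟨N, hN'⟩ : ∃ N, (missing D X Xᶜ).card = N + 4 := ⟨(missing D X Xᶜ).card - 4, by omega⟩
    obtain ⟨j, hj⟩ : ∃ j, Fintype.card V = N + 4 + 1 + (j + 4) := ⟨Fintype.card V - N - 9, by omega⟩
    rw [hN', hj] at h1
    rw [hj]
    have e1 : N + 4 + 1 + (j + 4) - (N + 4) - 1 = j + 4 := by omega
    have e2 : N + 4 + 1 + (j + 4) - 5 = N + j + 4 := by omega
    rw [e1] at h1
    rw [e2]
    nlinarith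
  · -- `N₀ ≥ k − 4`: every missing pair pays `≥ 4`
    have hsum : ∑ h ∈ missing D X Xᶜ, (deg D h.1 + deg D h.2) =
        ∑ x ∈ X, miss D Xᶜ x * deg D x + ∑ y ∈ Xᶜ, (X.filter (fun x => ¬ D.Adj x y)).card * deg D y := by
      rw [sum_add_distrib, sum_deg_fst_missing, sum_deg_snd_missing]
    have h4 : ∀ h ∈ missing D X Xᶜ, 4 ≤ deg D h.1 + deg D h.2 := by
      intro h _
      have := hdeg h.1
      have := hdeg h.2
      omega
    have hS := sum_le_sum h4
    rw [sum_const, smul_eq_mul, hsum] at hS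
    omega

/-- `bipartite_stability_four` in cherries: `2·Σ_v C(d(v), 2) + 2m + 4 (k − 5) ≤ m·k`. -/
theorem bipartite_stability_four_cherries (D : SimpleGraph V) [DecidableRel D.Adj] (X : Finset V)
    (hbip : ∀ x y, D.Adj x y → (x ∈ X ↔ y ∉ X)) (hN : 4 ≤ (missing D X Xᶜ).card)
    (hdeg : ∀ z, 2 ≤ deg D z) :
    2 * cherries D + 2 * D.edgeFinset.card + 4 * (Fintype.card V - 5) ≤
      D.edgeFinset.card * Fintype.card V := by
  have h1 := bipartite_stability_four D X hbip hN hdeg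
  have h2 := two_mul_cherries_add D
  have h3 := sum_deg_eq D
  omega

end C047

end TriangleCap

end PercRepro
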